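/-
Copyright (c) 2026. All rights reserved.
Released under Apache 2.0 license as described in the file LICENSE.
-/
import Mathlib
import Summits.MatrixMultiplication.MatrixMultiplication.Theorems.SubgroupIdentityDesigns.Negative.ExceptionalMember

/-!
# The order sieve for the `(2,1)` cell, in Lean: empty for every prime `p ≥ 7`, `p ≠ 31`

Route `LevelGradedCohnUmans`, crux `SubgroupIdentityDesigns` (stmt-MatrixMultiplication-14079), the
`(m,k) = (2,1)` cell.  VALUE = THEOREM / DECIDABLE VERDICT on one cell, NOT summit progress: the
crux quantifies over all `(p, m, k)` and stays open.

`levelOne_witness_sieve_profile`: a `(2,1)` witness at `p ≥ 7` (`0 < ε ≤ 1`) yields naturals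
`N ∈ {12,24,60}` (image of the exceptional member `E`, `|E| = z_E N`, `2 ∣ z_E`), scalar parts
`z_E, z₂, z₃` (pairwise coprime, product `∣ p - 1`) and Cartan-type images `v₂, v₃ ≤ p + 1` of the
two other members (`|Hⱼ| = zⱼ vⱼ`), subject to the window, the three walls and the volume floor —
all of them theorems of this directory.  `sieveKill p` is a Boolean test (a relaxed version of the
profile constraints, loops only over divisors of `p - 1`) with `sieveKill_sound`: if it returns
`true`, no profile exists.  `decide` evaluates it at `p ∈ {7, …, 43} ∖ {31}`, and with
`DicksonTheorem.cellTwoOne_empty` (`p ≥ 47`):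

* **`cellTwoOne_empty_of_ne_31`: the `(2,1)` cell is EMPTY for every prime `p ≥ 7`, `p ≠ 31`,
  and every `0 < ε ≤ 1`.**  (`p = 3`: `PThree`; `p = 31` has genuine order profiles around
  `2·A₅ ≤ GL₂(𝔽₃₁)` and stays DATA — kit job j126482; `p ∈ {2, 5}` not treated here.)

Report: `run/shared/lean/b2b/levelgraded-cu/ORACLE-g17.md` (§G17-2d).
-/

set_option linter.dupNamespace false

noncomputable section

open scoped BigOperators Classical

open Summit.MatrixMultiplication.MatrixMultiplication.Theorems.LieRankDesigns.Negative (GLm Mat budget)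
open Literature.Barriers.MatrixMultiplication (SubgroupTPP)

namespace Summit.MatrixMultiplication.MatrixMultiplication.Theorems.SubgroupIdentityDesigns.Negative

section OrderSieve

variable {p : ℕ} [hp : Fact p.Prime]

/-! ### The arithmetic profile of a witness -/

/-- Profile of an ordered triple (exceptional member `E`, Cartan-type members `A`, `B`) — pure
packaging of `card_eq_scalar_mul_card_image`, `image_le_of_neg_one_not_mem` and `-1 ∈ E`. -/
theorem sieve_profile_of_members (hp3 : 3 ≤ p) {n : ZMod p} (hn : ∀ x : ZMod p, x * x ≠ n)
    {E A B : Subgroup (GLm p 2)} (hAK : ¬ p ∣ Nat.card A) (hBK : ¬ p ∣ Nat.card B)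
    (hAF : ∃ a : Fin 2 → ZMod p, a ≠ 0 ∧ ∀ h ∈ A, ((h : GLm p 2) : Mat p 2).mulVec a = a → h = 1)
    (hBF : ∃ a : Fin 2 → ZMod p, a ≠ 0 ∧ ∀ h ∈ B, ((h : GLm p 2) : Mat p 2).mulVec a = a → h = 1)
    (hAneg : scalarHom p 2 (-1) ∉ A) (hBneg : scalarHom p 2 (-1) ∉ B)
    (hmem : scalarHom p 2 (-1) ∈ E) {N : ℕ}
    (hcard : Nat.card E = Nat.card (E.comap (scalarHom p 2)) * N)
    (hEA : Nat.Coprime (Nat.card (E.comap (scalarHom p 2))) (Nat.card (A.comap (scalarHom p 2))))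
    (hEB : Nat.Coprime (Nat.card (E.comap (scalarHom p 2))) (Nat.card (B.comap (scalarHom p 2))))
    (hAB : Nat.Coprime (Nat.card (A.comap (scalarHom p 2))) (Nat.card (B.comap (scalarHom p 2))))
    (hprod : Nat.card (E.comap (scalarHom p 2)) * Nat.card (A.comap (scalarHom p 2)) *
      Nat.card (B.comap (scalarHom p 2)) ∣ p - 1)
    (hwinE : Nat.card E ≤ p ^ 2 - 3) (hwinA : p + 1 ≤ Nat.card A) (hwinB : p + 1 ≤ Nat.card B)
    (hwEA : Nat.card E * Nat.card A + 2 * p ≤ (p + 1) * (p ^ 2 - 1))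
    (hwEB : Nat.card E * Nat.card B + 2 * p ≤ (p + 1) * (p ^ 2 - 1))
    (hwAB : Nat.card A * Nat.card B + 2 * p ≤ (p + 1) * (p ^ 2 - 1))
    (hfloor : 1 + p ^ 3 + (p - 2) * (p + 1) ^ 3 < Nat.card E * Nat.card A * Nat.card B) :
    ∃ zE z₂ z₃ v₂ v₃ : ℕ, 2 ∣ zE ∧ zE * z₂ * z₃ ∣ p - 1 ∧
      Nat.Coprime zE z₂ ∧ Nat.Coprime zE z₃ ∧ Nat.Coprime z₂ z₃ ∧ v₂ ≤ p + 1 ∧ v₃ ≤ p + 1 ∧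
      p + 1 ≤ z₂ * v₂ ∧ p + 1 ≤ z₃ * v₃ ∧ zE * N ≤ p ^ 2 - 3 ∧
      zE * N * (z₂ * v₂) + 2 * p ≤ (p + 1) * (p ^ 2 - 1) ∧
      zE * N * (z₃ * v₃) + 2 * p ≤ (p + 1) * (p ^ 2 - 1) ∧
      z₂ * v₂ * (z₃ * v₃) + 2 * p ≤ (p + 1) * (p ^ 2 - 1) ∧
      1 + p ^ 3 + (p - 2) * (p + 1) ^ 3 < zE * N * (z₂ * v₂) * (z₃ * v₃) := by
  have hp2 : p ≠ 2 := by omega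
  have hA := card_eq_scalar_mul_card_image A
  have hB := card_eq_scalar_mul_card_image B
  rw [hcard] at hwinE hwEA hwEB hfloor
  rw [hA] at hwinA hwEA hwAB hfloor
  rw [hB] at hwinB hwEB hwAB hfloor
  refine ⟨_, _, _, _, _, ?_, hprod, hEA, hEB, hAB,
    image_le_of_neg_one_not_mem hp3 hn hAK hAF hAneg,
    image_le_of_neg_one_not_mem hp3 hn hBK hBF hBneg,
    hwinA, hwinB, hwinE, hwEA, hwEB, hwAB, hfloor⟩
  exact two_dvd_card_comap_of_neg_one_mem hp2 hmem

/-- **The arithmetic profile of a `(2,1)` witness** (`p ≥ 7`, `0 < ε ≤ 1`). -/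
theorem levelOne_witness_sieve_profile (hp7 : 7 ≤ p) {ε : ℝ} (hε : 0 < ε) (hε1 : ε ≤ 1)
    {H₁ H₂ H₃ : Subgroup (GLm p 2)} (htpp : SubgroupTPP H₁ H₂ H₃)
    (hdesign : ∃ c : Mat p 2 → ℂ, (∀ M, 1 < M.rank → c M = 0) ∧
      (∑ M, c M * ZMod.stdAddChar (Matrix.trace (M * ((1 : GLm p 2) : Mat p 2)))) = 1 ∧
      ∀ a ∈ H₁, ∀ b ∈ H₂, ∀ g ∈ H₃, a * b * g ≠ 1 →
        (∑ M, c M *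
          ZMod.stdAddChar (Matrix.trace (M * ((a * b * g : GLm p 2) : Mat p 2)))) = 0)
    (hwit : budget p 2 1 (2 + ε) <
      ((Nat.card H₁ * Nat.card H₂ * Nat.card H₃ : ℕ) : ℝ) ^ ((2 + ε) / 3)) :
    ∃ N zE z₂ z₃ v₂ v₃ : ℕ, (N = 12 ∨ N = 24 ∨ N = 60) ∧ N ∣ (p - 1) * (p + 1) ∧
      2 ∣ zE ∧ zE * z₂ * z₃ ∣ p - 1 ∧
      Nat.Coprime zE z₂ ∧ Nat.Coprime zE z₃ ∧ Nat.Coprime z₂ z₃ ∧ v₂ ≤ p + 1 ∧ v₃ ≤ p + 1 ∧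
      p + 1 ≤ z₂ * v₂ ∧ p + 1 ≤ z₃ * v₃ ∧ zE * N ≤ p ^ 2 - 3 ∧
      zE * N * (z₂ * v₂) + 2 * p ≤ (p + 1) * (p ^ 2 - 1) ∧
      zE * N * (z₃ * v₃) + 2 * p ≤ (p + 1) * (p ^ 2 - 1) ∧
      z₂ * v₂ * (z₃ * v₃) + 2 * p ≤ (p + 1) * (p ^ 2 - 1) ∧
      1 + p ^ 3 + (p - 2) * (p + 1) ^ 3 < zE * N * (z₂ * v₂) * (z₃ * v₃) := by
  have hp2 : p ≠ 2 := by omega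
  have hp3 : 3 ≤ p := by omega
  obtain ⟨n, hn⟩ := FiniteField.exists_nonsquare (F := ZMod p) (by
    rw [ZMod.ringChar_zmod_n]; exact hp2)
  have hn' : ∀ x : ZMod p, x * x ≠ n := fun x hx => hn ⟨x, hx.symm⟩
  obtain ⟨-, hK₁, hK₂, hK₃⟩ := levelOne_witness_pfree_profile hp3 hε hε1 htpp hdesign hwit
  obtain ⟨hF₁, hF₂, hF₃⟩ := levelOne_witness_free_vector hp3 hε hε1 htpp hdesign hwit
  obtain ⟨h12, h13, h23⟩ := neg_one_mem_atMostOne hp2 htpp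
  obtain ⟨c₁₂, c₁₃, c₂₃, hprod⟩ := scalar_law htpp
  obtain ⟨⟨hlo₁, hhi₁⟩, ⟨hlo₂, hhi₂⟩, ⟨hlo₃, hhi₃⟩⟩ :=
    levelOne_witness_window hp3 (by linarith) hε1 htpp hdesign hwit
  have hwalls : ¬ ((p + 1) * (p ^ 2 - 1) < Nat.card H₁ * Nat.card H₃ + 2 * p ∨
      (p + 1) * (p ^ 2 - 1) < Nat.card H₁ * Nat.card H₂ + 2 * p ∨
      (p + 1) * (p ^ 2 - 1) < Nat.card H₂ * Nat.card H₃ + 2 * p) :=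
    fun h => StandardLines.no_levelOne_design_of_walls H₁ H₂ H₃ htpp h hdesign
  push Not at hwalls
  obtain ⟨hw₁₃, hw₁₂, hw₂₃⟩ := hwalls
  have hfloor : 1 + p ^ 3 + (p - 2) * (p + 1) ^ 3 < Nat.card H₁ * Nat.card H₂ * Nat.card H₃ := by
    by_contra hle
    exact no_levelOne_witness_of_volume_le_nat (by linarith) hε1 (Nat.le_of_not_lt hle) hwit
  obtain ⟨H, hH, hmem, N, hN, hdvd, hcard, -⟩ :=
    levelOne_witness_exceptional_member hp7 hn' hε hε1 htpp hdesign hwit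
  rcases hH with rfl | rfl | rfl
  · obtain ⟨zE, z₂, z₃, v₂, v₃, hrest⟩ := sieve_profile_of_members hp3 hn' hK₂ hK₃ hF₂ hF₃
      (fun h => h12 ⟨hmem, h⟩) (fun h => h13 ⟨hmem, h⟩) hmem hcard c₁₂ c₁₃ c₂₃ hprod
      hhi₁ hlo₂ hlo₃ hw₁₂ hw₁₃ hw₂₃ hfloor
    exact ⟨N, zE, z₂, z₃, v₂, v₃, hN, hdvd, hrest⟩
  · obtain ⟨zE, z₂, z₃, v₂, v₃, hrest⟩ := sieve_profile_of_members hp3 hn' hK₁ hK₃ hF₁ hF₃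
      (fun h => h12 ⟨h, hmem⟩) (fun h => h23 ⟨hmem, h⟩) hmem hcard c₁₂.symm c₂₃ c₁₃
      (by simpa only [mul_comm, mul_left_comm, mul_assoc] using hprod)
      hhi₂ hlo₁ hlo₃ (by rwa [mul_comm (Nat.card H)]) hw₂₃ hw₁₃
      (by simpa only [mul_comm, mul_left_comm, mul_assoc] using hfloor)
    exact ⟨N, zE, z₂, z₃, v₂, v₃, hN, hdvd, hrest⟩
  · obtain ⟨zE, z₂, z₃, v₂, v₃, hrest⟩ := sieve_profile_of_members hp3 hn' hK₁ hK₂ hF₁ hF₂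
      (fun h => h13 ⟨h, hmem⟩) (fun h => h23 ⟨h, hmem⟩) hmem hcard c₁₃.symm c₂₃.symm c₁₂
      (by simpa only [mul_comm, mul_left_comm, mul_assoc] using hprod)
      hhi₃ hlo₁ hlo₂ (by rwa [mul_comm (Nat.card H)]) (by rwa [mul_comm (Nat.card H)]) hw₁₂
      (by simpa only [mul_comm, mul_left_comm, mul_assoc] using hfloor)
    exact ⟨N, zE, z₂, z₃, v₂, v₃, hN, hdvd, hrest⟩

end OrderSieve

/-! ### The Boolean sieve -/

section Sieve

/-- The divisors of `p - 1` below `p`, as a list. -/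
def divList (p : ℕ) : List ℕ := (List.range p).filter (fun z => z ∣ p - 1)

/-- Relaxed kill test for one candidate `(N, z_E, z₂, z₃)`: `true` means no images `v₂, v₃`
complete it to a profile. -/
def killQuad (p N zE z₂ z₃ : ℕ) : Bool :=
  let W := (p + 1) * (p ^ 2 - 1) - 2 * p
  let F := 1 + p ^ 3 + (p - 2) * (p + 1) ^ 3
  let cE := zE * N
  let v₂ := min (p + 1) (W / (cE * z₂))
  let v₃ := min (p + 1) (W / (cE * z₃))
  let P := min (v₂ * v₃) (W / (z₂ * z₃))
  !decide (N ∣ (p - 1) * (p + 1)) || !decide (2 ∣ zE) || !decide (zE * z₂ * z₃ ∣ p - 1) ||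
    !decide (Nat.Coprime zE z₂) || !decide (Nat.Coprime zE z₃) || !decide (Nat.Coprime z₂ z₃) ||
    decide (p ^ 2 - 3 < cE) || decide (z₂ * v₂ < p + 1) || decide (z₃ * v₃ < p + 1) ||
    decide (cE * z₂ * z₃ * P ≤ F)

/-- The sieve: every candidate quadruple is killed. -/
def sieveKill (p : ℕ) : Bool :=
  [12, 24, 60].all fun N => (divList p).all fun zE => (divList p).all fun z₂ =>
    (divList p).all fun z₃ => killQuad p N zE z₂ z₃

/-- A divisor of `p - 1` (for `p ≥ 2`) is listed in `divList p`. -/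
theorem mem_divList {p z : ℕ} (hp : 2 ≤ p) (hz : z ∣ p - 1) : z ∈ divList p := by
  rw [divList, List.mem_filter, List.mem_range, decide_eq_true_eq]
  refine ⟨?_, hz⟩
  have := Nat.le_of_dvd (by omega) hz
  omega

/-- **Soundness of the sieve**: if `sieveKill p = true` then no arithmetic profile exists. -/
theorem sieveKill_sound {p : ℕ} (hp : 2 ≤ p) (hk : sieveKill p = true)
    {N zE z₂ z₃ v₂ v₃ : ℕ} (hN : N = 12 ∨ N = 24 ∨ N = 60) (hNd : N ∣ (p - 1) * (p + 1))
    (h2 : 2 ∣ zE) (hprod : zE * z₂ * z₃ ∣ p - 1)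
    (hc₁ : Nat.Coprime zE z₂) (hc₂ : Nat.Coprime zE z₃) (hc₃ : Nat.Coprime z₂ z₃)
    (hv₂ : v₂ ≤ p + 1) (hv₃ : v₃ ≤ p + 1)
    (hlo₂ : p + 1 ≤ z₂ * v₂) (hlo₃ : p + 1 ≤ z₃ * v₃) (hhi : zE * N ≤ p ^ 2 - 3)
    (hw₂ : zE * N * (z₂ * v₂) + 2 * p ≤ (p + 1) * (p ^ 2 - 1))
    (hw₃ : zE * N * (z₃ * v₃) + 2 * p ≤ (p + 1) * (p ^ 2 - 1))
    (hw₂₃ : z₂ * v₂ * (z₃ * v₃) + 2 * p ≤ (p + 1) * (p ^ 2 - 1))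
    (hfloor : 1 + p ^ 3 + (p - 2) * (p + 1) ^ 3 < zE * N * (z₂ * v₂) * (z₃ * v₃)) : False := by
  -- locate the candidate in the loops
  have hzE : zE ∈ divList p := mem_divList hp (Dvd.dvd.trans (Dvd.intro _ rfl) (
    Dvd.dvd.trans (Dvd.intro _ rfl) hprod))
  have hz₂ : z₂ ∈ divList p := mem_divList hp
    (Dvd.dvd.trans (Dvd.intro_left _ rfl) (Dvd.dvd.trans (Dvd.intro _ rfl) hprod))
  have hz₃ : z₃ ∈ divList p := mem_divList hp (Dvd.dvd.trans (Dvd.intro_left _ rfl) hprod)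
  have hNmem : N ∈ [12, 24, 60] := by
    rcases hN with rfl | rfl | rfl <;> simp
  have hq : killQuad p N zE z₂ z₃ = true := by
    rw [sieveKill, List.all_eq_true] at hk
    have h1 := hk N hNmem
    rw [List.all_eq_true] at h1
    have h2' := h1 zE hzE
    rw [List.all_eq_true] at h2'
    have h3 := h2' z₂ hz₂
    rw [List.all_eq_true] at h3
    exact h3 z₃ hz₃
  simp only [killQuad, Bool.or_eq_true, Bool.not_eq_true', decide_eq_false_iff_not,
    decide_eq_true_eq] at hq
  -- name the atoms
  set W₀ := (p + 1) * (p ^ 2 - 1) with hW₀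
  set F := 1 + p ^ 3 + (p - 2) * (p + 1) ^ 3 with hF
  set cE := zE * N with hcE
  have hzE0 : 0 < zE := by
    rcases Nat.eq_zero_or_pos zE with h0 | h0
    · exfalso; rw [h0, zero_mul, zero_mul, zero_dvd_iff] at hprod; omega
    · exact h0
  have hN0 : 0 < N := by rcases hN with rfl | rfl | rfl <;> norm_num
  have hcE0 : 0 < cE := Nat.mul_pos hzE0 hN0
  have hz₂0 : 0 < z₂ := Nat.pos_of_ne_zero (fun h0 => by rw [h0, zero_mul] at hlo₂; omega)
  have hz₃0 : 0 < z₃ := Nat.pos_of_ne_zero (fun h0 => by rw [h0, zero_mul] at hlo₃; omega)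
  -- the true images are below the relaxed maxima
  have hV₂ : v₂ ≤ min (p + 1) ((W₀ - 2 * p) / (cE * z₂)) := by
    refine le_min hv₂ ?_
    rw [Nat.le_div_iff_mul_le (Nat.mul_pos hcE0 hz₂0)]
    have : cE * (z₂ * v₂) ≤ W₀ - 2 * p := by omega
    calc v₂ * (cE * z₂) = cE * (z₂ * v₂) := by ring
      _ ≤ W₀ - 2 * p := this
  have hV₃ : v₃ ≤ min (p + 1) ((W₀ - 2 * p) / (cE * z₃)) := by
    refine le_min hv₃ ?_
    rw [Nat.le_div_iff_mul_le (Nat.mul_pos hcE0 hz₃0)]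
    have : cE * (z₃ * v₃) ≤ W₀ - 2 * p := by omega
    calc v₃ * (cE * z₃) = cE * (z₃ * v₃) := by ring
      _ ≤ W₀ - 2 * p := this
  have hP : v₂ * v₃ ≤ min (min (p + 1) ((W₀ - 2 * p) / (cE * z₂)) *
      min (p + 1) ((W₀ - 2 * p) / (cE * z₃))) ((W₀ - 2 * p) / (z₂ * z₃)) := by
    refine le_min (Nat.mul_le_mul hV₂ hV₃) ?_
    rw [Nat.le_div_iff_mul_le (Nat.mul_pos hz₂0 hz₃0)]
    have : z₂ * v₂ * (z₃ * v₃) ≤ W₀ - 2 * p := by omega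
    calc v₂ * v₃ * (z₂ * z₃) = z₂ * v₂ * (z₃ * v₃) := by ring
      _ ≤ W₀ - 2 * p := this
  have hVol : cE * (z₂ * v₂) * (z₃ * v₃) = cE * z₂ * z₃ * (v₂ * v₃) := by ring
  -- read off the kill test
  rcases hq with ((((((((hq | hq) | hq) | hq) | hq) | hq) | hq) | hq) | hq) | hq
  · exact hq hNd
  · exact hq h2
  · exact hq hprod
  · exact hq hc₁
  · exact hq hc₂
  · exact hq hc₃
  · omega
  · exact absurd (lt_of_lt_of_le hq (le_trans hlo₂ (Nat.mul_le_mul_left _ hV₂))) (lt_irrefl _)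
  · exact absurd (lt_of_lt_of_le hq (le_trans hlo₃ (Nat.mul_le_mul_left _ hV₃))) (lt_irrefl _)
  · have hle := Nat.mul_le_mul_left (cE * z₂ * z₃) hP
    rw [← hVol] at hle
    exact absurd (lt_of_lt_of_le hfloor (hle.trans hq)) (lt_irrefl _)

end Sieve

/-! ### The verdicts -/

section Verdicts

variable {p : ℕ} [hp : Fact p.Prime]

/-- A prime `p ≥ 7` at which the sieve returns `true` carries no `(2,1)` witness (`0 < ε ≤ 1`). -/
theorem cellTwoOne_empty_of_sieveKill (hp7 : 7 ≤ p) (hk : sieveKill p = true)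
    {ε : ℝ} (hε : 0 < ε) (hε1 : ε ≤ 1)
    {H₁ H₂ H₃ : Subgroup (GLm p 2)} (htpp : SubgroupTPP H₁ H₂ H₃)
    (hdesign : ∃ c : Mat p 2 → ℂ, (∀ M, 1 < M.rank → c M = 0) ∧
      (∑ M, c M * ZMod.stdAddChar (Matrix.trace (M * ((1 : GLm p 2) : Mat p 2)))) = 1 ∧
      ∀ a ∈ H₁, ∀ b ∈ H₂, ∀ g ∈ H₃, a * b * g ≠ 1 →
        (∑ M, c M *
          ZMod.stdAddChar (Matrix.trace (M * ((a * b * g : GLm p 2) : Mat p 2)))) = 0) :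
    ¬ budget p 2 1 (2 + ε) <
      ((Nat.card H₁ * Nat.card H₂ * Nat.card H₃ : ℕ) : ℝ) ^ ((2 + ε) / 3) := by
  intro hwit
  obtain ⟨N, zE, z₂, z₃, v₂, v₃, hN, hNd, h2, hprod, hc₁, hc₂, hc₃, hv₂, hv₃, hlo₂, hlo₃, hhi,
    hw₂, hw₃, hw₂₃, hfloor⟩ := levelOne_witness_sieve_profile hp7 hε hε1 htpp hdesign hwit
  exact sieveKill_sound (by omega) hk hN hNd h2 hprod hc₁ hc₂ hc₃ hv₂ hv₃ hlo₂ hlo₃ hhi hw₂ hw₃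
    hw₂₃ hfloor

/-- The sieve kills every prime `7 ≤ p ≤ 43` except `p = 31` (kernel evaluation). -/
theorem sieveKill_list : ∀ q ∈ [7, 11, 13, 17, 19, 23, 29, 37, 41, 43], sieveKill q = true := by
  decide +kernel

/-- At `p = 31` the sieve does NOT kill (the profiles around `2·A₅ ≤ GL₂(𝔽₃₁)`, image `60`,
survive the arithmetic): recorded so that nobody mistakes the gap for an oversight. -/
theorem sieveKill_31 : sieveKill 31 = false := by decide +kernel

/-- **The `(2,1)` cell of `SubgroupIdentityDesigns` is empty for every prime `p ≥ 7` other than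
`31`** (`0 < ε ≤ 1`): no subgroup triple of `GL₂(𝔽_p)` with the TPP and a rank-`≤ 1` identity
design beats `budget^{(2+ε)/3}`.  Decidable verdict on one cell — NOT summit progress. -/
theorem cellTwoOne_empty_of_ne_31 (hp7 : 7 ≤ p) (hp31 : p ≠ 31) {ε : ℝ} (hε : 0 < ε)
    (hε1 : ε ≤ 1) {H₁ H₂ H₃ : Subgroup (GLm p 2)} (htpp : SubgroupTPP H₁ H₂ H₃)
    (hdesign : ∃ c : Mat p 2 → ℂ, (∀ M, 1 < M.rank → c M = 0) ∧
      (∑ M, c M * ZMod.stdAddChar (Matrix.trace (M * ((1 : GLm p 2) : Mat p 2)))) = 1 ∧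
      ∀ a ∈ H₁, ∀ b ∈ H₂, ∀ g ∈ H₃, a * b * g ≠ 1 →
        (∑ M, c M *
          ZMod.stdAddChar (Matrix.trace (M * ((a * b * g : GLm p 2) : Mat p 2)))) = 0) :
    ¬ budget p 2 1 (2 + ε) <
      ((Nat.card H₁ * Nat.card H₂ * Nat.card H₃ : ℕ) : ℝ) ^ ((2 + ε) / 3) := by
  by_cases hp47 : 47 ≤ p
  · exact cellTwoOne_empty hp47 hε hε1 htpp hdesign
  · have hp' := hp.out
    have hk : sieveKill p = true := by
      apply sieveKill_list
      interval_cases p <;> first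
        | exact absurd rfl hp31
        | exact absurd hp' (by decide)
        | decide
    exact cellTwoOne_empty_of_sieveKill hp7 hk hε hε1 htpp hdesign

end Verdicts

end Summit.MatrixMultiplication.MatrixMultiplication.Theorems.SubgroupIdentityDesigns.Negative

end
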